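import Summits.CriticalPhenomena.SAWScalingLimit.Theorems.SAWDevelopingMapHexConjectureTriangleArchTransfer
import Summits.CriticalPhenomena.SAWScalingLimit.Theorems.SAWDevelopingMapHexConjectureTriangleChart
import HarnessLib

/-!
# Crux `HexConjecture` (stmt-CriticalPhenomena-0808), line `root-locality-replaces-loewner`:
the side-floor comparison implies the window two-point lower bound

Landing target:
`Summits/CriticalPhenomena/SAWScalingLimit/Theorems/SAWDevelopingMapHexConjectureWindowTwoPointOfSideFloor.lean`
(`--supports stmt-CriticalPhenomena-0808`; registered stub
`stub_windowTwoPoint_of_sideFloorComparison`, the glue SFB ⟹ WTLB of lead c11 / strategist s2).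

The SIDE-FLOOR COMPARISON (SFB) bounds the Glazman–Manolescu triangle tail `triDl L` — the
`x_c`-mass of the mid-edge walks of the lattice triangle `T_L = HV.triV L` from its base mid-edge
leaving through the left side — by `C ×` the coded floor-arrival mass of the same triangle at the
base abscissae `d ∈ [L/4, L/2]`.  The WINDOW TWO-POINT LOWER BOUND (WTLB) asks, for every large
radius `R`, root cell `x`, the upper half-box `B = {v : rows ≥ x₁, |c_v - mid s_x| ≤ R}` and the
lattice window `S' = [θ_a R, θ_b R] ∩ ℤ`, that
`triDl ⌊R/4⌋ ≤ C · Σ_{d ∈ S'} Z_B(s_x → t_{x + d e₀})`.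

SFB ⟹ WTLB with `θ_a = 1/20`, `θ_b = 1/8`, the constant `max C 1`, `R₀ = max 80 (4 L₀ + 8)`:
for `L = ⌊R/4⌋` the coded floor-arrival mass of `T_L` at abscissa `d`, `|d| ≤ L`, IS the floor
arch mass `Z_{T_x(L)}(s_x → t_{x + d e₀})` of the chart preimage `T_x(L)` of the triangle
(`triArch_archMass_offset_eq`); `T_x(L) ⊆ B` because its vertices lie in the rows `≥ x₁` within
distance `3L + 2 ≤ R` of `mid s_x` (`triChart_geometry`), so `Z_{T_x(L)} ≤ Z_B` (exact
restriction, `archMass_mono`); and `[⌊L/4⌋, ⌊L/2⌋] ⊆ [R/20, R/8]` for `R ≥ 80`, the extra offsets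
adding nonnegative terms.  (Same three steps as the cube version `…WindowMassCube.lean`, with the
triangle in place of the strip.)
-/

noncomputable section

open scoped BigOperators Topology Classical
open Literature.Probability.LatticeModels (HexVertex hexGraph hexCenter Site)
open Literature.Probability.RandomPlanarGeometry Literature.Probability.RandomPlanarGeometry.SAW
  Literature.Probability.RandomPlanarGeometry.SAW.HV
open Summit.CriticalPhenomena.SAWScalingLimit.Theorems.ObservableToSLE.FloorRatio

namespace Summit.CriticalPhenomena.SAWScalingLimit.Theorems.HexConjecture.RootLocality

/-- **The triangle preimage `T_x(L)` lies in the upper half-box of radius `R`** as soon as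
`3L + 2 ≤ R`: its vertices are in the rows `≥ x₁` within distance `3L + 2` of `mid s_x`
(`triChart_geometry`). [cite: GlazmanManolescu2019, §4.1 (T_L)] -/
theorem sideFloor_triChart_subset_halfBox (x : Site 2) (L : ℕ) {R : ℝ}
    (hR : 3 * (L : ℝ) + 2 ≤ R) {B : Finset HexVertex}
    (hB : ∀ v : HexVertex, v ∈ B ↔ (x 1 ≤ v.1 1 ∧
      dist (hexCenter v) (hexMidpoint s((x - Pi.single 1 1, 1), (x, 0))) ≤ R)) :
    (triV L).map (hvIso.trans (shift (-(x 0)) (-(x 1)))).symm.toEquiv.toEmbedding ⊆ B := by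
  intro w hw
  have hg := triChart_geometry (x := x) (L := L) hw
  rw [hB]
  exact ⟨hg.1, hg.2.trans hR⟩

/-- **The base window `[⌊L/4⌋, ⌊L/2⌋]` lies in the lattice window `[R/20, R/8]`** for
`L = ⌊R/4⌋` and `R ≥ 80`: `d ≥ ⌊L/4⌋ ≥ (L - 3)/4 > R/16 - 1 ≥ R/20` and `d ≤ L/2 ≤ R/8`.
[folklore] -/
theorem sideFloor_Icc_subset_window {R : ℝ} (hR : 80 ≤ R) {S' : Finset ℤ}
    (hS' : ∀ d : ℤ, d ∈ S' ↔ ((1 / 20 : ℝ) * R ≤ (d : ℝ) ∧ (d : ℝ) ≤ (1 / 8 : ℝ) * R)) :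
    Finset.Icc (((⌊R / 4⌋₊ : ℕ) : ℤ) / 4) (((⌊R / 4⌋₊ : ℕ) : ℤ) / 2) ⊆ S' := by
  intro d hd
  rw [Finset.mem_Icc] at hd
  rw [hS']
  have hL1 : ((⌊R / 4⌋₊ : ℕ) : ℝ) ≤ R / 4 := Nat.floor_le (by positivity)
  have hL2 : R / 4 < ((⌊R / 4⌋₊ : ℕ) : ℝ) + 1 := Nat.lt_floor_add_one _
  have h1 : ((⌊R / 4⌋₊ : ℕ) : ℤ) - 3 ≤ 4 * d := by omega
  have h2 : 2 * d ≤ ((⌊R / 4⌋₊ : ℕ) : ℤ) := by omega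
  have h1' : ((⌊R / 4⌋₊ : ℕ) : ℝ) - 3 ≤ 4 * (d : ℝ) := by exact_mod_cast h1
  have h2' : 2 * (d : ℝ) ≤ ((⌊R / 4⌋₊ : ℕ) : ℝ) := by exact_mod_cast h2
  constructor
  · linarith
  · linarith

/-- **Registered sub-goal `stub_windowTwoPoint_of_sideFloorComparison`** (crux item
stmt-CriticalPhenomena-0808, line `root-locality-replaces-loewner`, lead c11; strategist s2's glue
stub): the side-floor comparison SFB — inside one lattice triangle `T_L`, side exits
`triDl L ≤ C ×` floor arrivals in the base window `[L/4, L/2]` for `L ≥ L₀` — implies the window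
two-point lower bound WTLB with `θ_a = 1/20`, `θ_b = 1/8`, the constant `max C 1` and
`R₀ = max 80 (4L₀ + 8)`: for `L = ⌊R/4⌋` the coded floor-arrival mass of `T_L` at abscissa `d`
is the floor arch mass of the chart triangle `T_x(L)` at offset `d` (`triArch_archMass_offset_eq`),
`T_x(L) ⊆ B_R(x)` (`triChart_geometry`, `3L + 2 ≤ R`) so exact restriction (`archMass_mono`)
bounds it by the arch mass of the half-box, and `[⌊L/4⌋, ⌊L/2⌋] ⊆ [R/20, R/8]`, the extra
offsets adding nonnegative terms. [cite: GlazmanManolescu2019, §4.1 (T_L)] -/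
theorem stub_windowTwoPoint_of_sideFloorComparison : (∃ C : ℝ, ∃ L₀ : ℕ, ∀ L : ℕ, L₀ ≤ L → Literature.Probability.RandomPlanarGeometry.SAW.HV.triDl L ≤ C * ∑ d ∈ Finset.Icc ((L : ℤ) / 4) ((L : ℤ) / 2), ∑ P ∈ (Literature.Probability.RandomPlanarGeometry.SAW.HV.midWalks (Literature.Probability.RandomPlanarGeometry.SAW.HV.triV L)).filter (fun P => Literature.Probability.RandomPlanarGeometry.SAW.HV.finalDart P = ((d, 0, false), (d, -1, true)) ∨ Literature.Probability.RandomPlanarGeometry.SAW.HV.finalDart P = ((d, -1, true), (d, 0, false))), Literature.Probability.RandomPlanarGeometry.SAW.hexCriticalFugacity ^ Literature.Probability.RandomPlanarGeometry.SAW.HV.mwLen P) → (∃ θa θb C : ℝ, 0 < θa ∧ θa < θb ∧ θb ≤ 1 / 4 ∧ 0 < C ∧ ∃ R₀ : ℝ, 0 < R₀ ∧ ∀ R : ℝ, R₀ ≤ R → ∀ (x : Literature.Probability.LatticeModels.Site 2) (B : Finset Literature.Probability.LatticeModels.HexVertex) (S' : Finset ℤ), (∀ v : Literature.Probability.LatticeModels.HexVertex,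 v ∈ B ↔ (x 1 ≤ v.1 1 ∧ dist (Literature.Probability.LatticeModels.hexCenter v) (Literature.Probability.RandomPlanarGeometry.SAW.hexMidpoint s((x - Pi.single 1 1, 1), (x, 0))) ≤ R)) → (∀ d : ℤ, d ∈ S' ↔ (θa * R ≤ (d : ℝ) ∧ (d : ℝ) ≤ θb * R)) → Literature.Probability.RandomPlanarGeometry.SAW.HV.triDl ⌊R / 4⌋₊ ≤ C * ∑ d ∈ S', ∑ γ : Literature.Probability.RandomPlanarGeometry.SAW.HexMidEdgeSAW B s((x - Pi.single 1 1, 1), (x, 0)) s((x + Pi.single 0 d - Pi.single 1 1, 1), (x + Pi.single 0 d, 0)), Literature.Probability.RandomPlanarGeometry.SAW.hexCriticalFugacity ^ γ.length) := by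
  rintro ⟨C, L₀, hSFB⟩
  refine ⟨1 / 20, 1 / 8, max C 1, by norm_num, by norm_num, by norm_num,
    lt_max_iff.2 (Or.inr one_pos), max 80 (4 * (L₀ : ℝ) + 8),
    lt_max_iff.2 (Or.inl (by norm_num)), ?_⟩
  intro R hR x B S' hB hS'
  have hR80 : (80 : ℝ) ≤ R := le_trans (le_max_left _ _) hR
  have hRL₀ : 4 * (L₀ : ℝ) + 8 ≤ R := le_trans (le_max_right _ _) hR
  -- the base window lies in the lattice window
  have hwin := sideFloor_Icc_subset_window hR80 hS'
  set L : ℕ := ⌊R / 4⌋₊ with hLdef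
  have hL1 : (L : ℝ) ≤ R / 4 := Nat.floor_le (by positivity)
  have hL₀ : L₀ ≤ L := Nat.le_floor (by linarith)
  -- the chart triangle `T_x(L)` and its inclusion in the half-box
  set T := (triV L).map (hvIso.trans (shift (-(x 0)) (-(x 1)))).symm.toEquiv.toEmbedding with hT
  have hsub : T ⊆ B := sideFloor_triChart_subset_halfBox x L (by linarith) hB
  set s : Sym2 HexVertex := s((x - Pi.single 1 1, 1), (x, 0)) with hs
  have hC : C ≤ max C 1 := le_max_left _ _
  have hC0 : (0 : ℝ) ≤ max C 1 := zero_le_one.trans (le_max_right _ _)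
  have hx0 : (0 : ℝ) ≤ hexCriticalFugacity := hexCriticalFugacity_pos_lt_one.1.le
  calc triDl L
      ≤ C * ∑ d ∈ Finset.Icc ((L : ℤ) / 4) ((L : ℤ) / 2),
          ∑ P ∈ (midWalks (triV L)).filter
              (fun P => finalDart P = ((d, 0, false), (d, -1, true)) ∨
                finalDart P = ((d, -1, true), (d, 0, false))),
            hexCriticalFugacity ^ mwLen P := hSFB L hL₀
    _ ≤ max C 1 * ∑ d ∈ Finset.Icc ((L : ℤ) / 4) ((L : ℤ) / 2),
          ∑ P ∈ (midWalks (triV L)).filter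
              (fun P => finalDart P = ((d, 0, false), (d, -1, true)) ∨
                finalDart P = ((d, -1, true), (d, 0, false))),
            hexCriticalFugacity ^ mwLen P :=
        mul_le_mul_of_nonneg_right hC
          (Finset.sum_nonneg fun _ _ => Finset.sum_nonneg fun _ _ => pow_nonneg hx0 _)
    _ = max C 1 * ∑ d ∈ Finset.Icc ((L : ℤ) / 4) ((L : ℤ) / 2),
          ∑ γ : HexMidEdgeSAW T s
            s((x + Pi.single 0 d - Pi.single 1 1, 1), (x + Pi.single 0 d, 0)),
            hexCriticalFugacity ^ γ.length := by
        congr 1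
        refine Finset.sum_congr rfl fun d hd => ?_
        rw [Finset.mem_Icc] at hd
        exact (triArch_archMass_offset_eq x L d ⟨by omega, by omega⟩).symm
    _ ≤ max C 1 * ∑ d ∈ Finset.Icc ((L : ℤ) / 4) ((L : ℤ) / 2),
          ∑ γ : HexMidEdgeSAW B s
            s((x + Pi.single 0 d - Pi.single 1 1, 1), (x + Pi.single 0 d, 0)),
            hexCriticalFugacity ^ γ.length :=
        mul_le_mul_of_nonneg_left (Finset.sum_le_sum fun d _ => archMass_mono hsub s _) hC0
    _ ≤ max C 1 * ∑ d ∈ S', ∑ γ : HexMidEdgeSAW B s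
            s((x + Pi.single 0 d - Pi.single 1 1, 1), (x + Pi.single 0 d, 0)),
            hexCriticalFugacity ^ γ.length :=
        mul_le_mul_of_nonneg_left
          (Finset.sum_le_sum_of_subset_of_nonneg hwin fun d _ _ => archMass_nonneg _ _ _) hC0

end Summit.CriticalPhenomena.SAWScalingLimit.Theorems.HexConjecture.RootLocality

end
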